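import Literature.Geometry.Kaehler.RiemannSurfaceHeinsUnivalence
import Mathlib.Analysis.Complex.Schwarz
import HarnessLib

/-!
# The extremal family of the unit disc: Heins' hypotheses hold at their model (Schwarz–Pick)

Topic `Literature/Geometry/Kaehler` (PROOF-ONLY: theorems, no definition, no instance, no named fact).
Companion of `RiemannSurfaceHeinsUnivalence.lean` (abc-iut cell, programme «UNIF-G1P» Tier 2, brick P4b;
GAP G-L4t8g7-2).  That file proves Heins' univalence theorem for an abstract **extremal family**
`f : R → R → ℂ` on a Riemann surface `R` — `f q` holomorphic into the unit disc, vanishing exactly at `q`,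
with the extremal property

  `(*4)  ∀ q F, F holomorphic → (∀ p, ‖F p‖ < 1) → F q = 0 → ∀ p, ‖F p‖ ≤ ‖f q p‖`

(I-Hsiung Lin, *Classical Complex Analysis: A Geometric Approach*, vol. 2 (2011), §7.6.1, proof of
(7.6.1.1), displays (*3)–(*5)).  Here we record that this typed interface is INHABITED by its intended
model: on the open unit disc `𝔻 ⊆ ℂ` (the tree's model `⟨ball 0 1, isOpen_ball⟩ : Opens ℂ` of
`exists_biholomorphic_disc_of_injective_mdifferentiable` / `exists_biholomorphic_disc_of_extremal`) the
Möbius family `f q p := φ_q(p) = (p - q)/(1 - q̄ p)` (`Complex.discMobius`, whose modulus is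
`exp (−g_𝔻(p, q))` for the Green's function `g_𝔻(p, q) = −log |φ_q(p)|` of the disc) satisfies all four
hypotheses, the extremal property (*4) being the **Schwarz–Pick lemma** (Schwarz's lemma, Mathlib's
`Complex.norm_le_norm_of_mapsTo_ball`, after the disc automorphism `φ_{−q}`; Lin vol. 1 §3.4.4, Conway
VI.2).  Consequently `RiemannSurface.injective_of_extremal` instantiates at the disc (non-vacuity of the
brick's hypotheses, "typed ≠ inhabited" discipline of the cell).

* (private plumbing) a function on an open subset of `ℂ`, as a manifold, is `ℂ`-differentiable at a point
  iff its total extension (by `0`) is;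
* `RiemannSurface.unitDisc_mdifferentiable_discMobius`, `unitDisc_norm_discMobius_lt_one`,
  `unitDisc_discMobius_eq_zero_iff` — hypotheses `hf`, `hlt`, `hz` of the brick at the model;
* `RiemannSurface.unitDisc_norm_le_norm_discMobius` — **Schwarz–Pick on the disc-as-a-manifold**: a
  holomorphic `F : 𝔻 → 𝔻` with `F q = 0` satisfies `‖F p‖ ≤ ‖φ_q(p)‖` = hypothesis `hext` (*4);
* `RiemannSurface.unitDisc_heinsHypotheses` — the four hypotheses packaged (NV witness);
* `RiemannSurface.unitDisc_injective_discMobius_of_extremal` — Heins' theorem applied at its model.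

Classical mathematics outside the [IUTchIII] Cor. 3.12 cone; nothing here takes a side there.

## References
* [Lin2011ClassicalComplexAnalysisII] I-Hsiung Lin, *Classical Complex Analysis: A Geometric Approach*,
  vol. 2 (2011), §7.6.1, proof of (7.6.1.1), (*3)–(*5).
* [Conway1978] J. B. Conway, *Functions of One Complex Variable* (1978), Ch. VI §2 (Schwarz's lemma,
  Prop. 2.2 the maps `φ_a`).
-/

noncomputable section

open Set Function Metric TopologicalSpace Complex
open scoped Manifold ContDiff ComplexConjugate

namespace Literature.Geometry.Kaehler

namespace RiemannSurface

/-! ### Functions on the disc-as-a-manifold versus total functions -/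

/-- On an open subset `U ⊆ ℂ` with its manifold structure, `p ↦ Φ p` is `ℂ`-differentiable at `x` (in
the manifold sense) iff the ambient `Φ : ℂ → ℂ` is complex differentiable at `x`. [folklore] -/
private theorem opens_mdifferentiableAt_comp_val_iff {U : Opens ℂ} (Φ : ℂ → ℂ) (x : U) :
    MDifferentiableAt 𝓘(ℂ, ℂ) 𝓘(ℂ, ℂ) (fun y : U => Φ y) x ↔ DifferentiableAt ℂ Φ x := by
  rw [← mdifferentiableAt_iff_differentiableAt]
  exact ((differentiableWithinAt_localInvariantProp (I := 𝓘(ℂ, ℂ))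
    (I' := 𝓘(ℂ, ℂ))).liftPropAt_iff_comp_subtype_val Φ x).symm

/-- A function `F` on an open subset `U ⊆ ℂ` (as a manifold) is `ℂ`-differentiable at `x` iff its total
extension by `0` is complex differentiable at `x`. [folklore] -/
private theorem unitDisc_mdifferentiableAt_iff {U : Opens ℂ} (F : U → ℂ) (x : U) :
    MDifferentiableAt 𝓘(ℂ, ℂ) 𝓘(ℂ, ℂ) F x ↔
      DifferentiableAt ℂ (Function.extend Subtype.val F fun _ => 0) x := by
  have hF : F = fun y : U => Function.extend Subtype.val F (fun _ => (0 : ℂ)) y :=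
    funext fun y => (Subtype.val_injective.extend_apply _ _ y).symm
  rw [← opens_mdifferentiableAt_comp_val_iff, ← hF]

/-- The total extension of a holomorphic function on the disc-as-a-manifold is holomorphic on the ball.
[folklore] -/
private theorem unitDisc_differentiableOn_extend
    {F : (⟨ball (0 : ℂ) 1, isOpen_ball⟩ : Opens ℂ) → ℂ} (hF : MDifferentiable 𝓘(ℂ, ℂ) 𝓘(ℂ, ℂ) F) :
    DifferentiableOn ℂ (Function.extend Subtype.val F fun _ => 0) (ball 0 1) := fun z hz =>
  ((unitDisc_mdifferentiableAt_iff F ⟨z, hz⟩).1 (hF ⟨z, hz⟩)).differentiableWithinAt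

/-! ### The Möbius family on the disc: hypotheses `hf`, `hlt`, `hz` of Heins' brick -/

/-- Points of the disc have norm `< 1`. [folklore] -/
private theorem unitDisc_norm_coe_lt_one (p : (⟨ball (0 : ℂ) 1, isOpen_ball⟩ : Opens ℂ)) : ‖(p : ℂ)‖ < 1 :=
  mem_ball_zero_iff.1 p.2

/-- `hf` at the model: `p ↦ φ_q(p)` is holomorphic on the disc-as-a-manifold.
[cite: Conway1978, Ch. VI Prop. 2.2] -/
theorem unitDisc_mdifferentiable_discMobius (q : (⟨ball (0 : ℂ) 1, isOpen_ball⟩ : Opens ℂ)) :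
    MDifferentiable 𝓘(ℂ, ℂ) 𝓘(ℂ, ℂ)
      (fun p : (⟨ball (0 : ℂ) 1, isOpen_ball⟩ : Opens ℂ) => discMobius (q : ℂ) (p : ℂ)) := fun p =>
  (opens_mdifferentiableAt_comp_val_iff (discMobius (q : ℂ)) p).2
    (differentiableAt_discMobius (unitDisc_norm_coe_lt_one q) (unitDisc_norm_coe_lt_one p).le)

/-- `hlt` at the model: `‖φ_q(p)‖ < 1`. [cite: Conway1978, Ch. VI Prop. 2.2] -/
theorem unitDisc_norm_discMobius_lt_one (q p : (⟨ball (0 : ℂ) 1, isOpen_ball⟩ : Opens ℂ)) :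
    ‖discMobius (q : ℂ) (p : ℂ)‖ < 1 :=
  norm_discMobius_lt_one (unitDisc_norm_coe_lt_one q) (unitDisc_norm_coe_lt_one p)

/-- `hz` at the model: `φ_q(p) = 0 ↔ p = q`. [cite: Conway1978, Ch. VI Prop. 2.2] -/
theorem unitDisc_discMobius_eq_zero_iff (q p : (⟨ball (0 : ℂ) 1, isOpen_ball⟩ : Opens ℂ)) :
    discMobius (q : ℂ) (p : ℂ) = 0 ↔ p = q := by
  rw [discMobius_eq_zero_iff (unitDisc_norm_coe_lt_one q) (unitDisc_norm_coe_lt_one p).le,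
    Subtype.ext_iff]

/-! ### Schwarz–Pick: the extremal property (*4) at the model -/

/-- **Schwarz–Pick on the disc-as-a-manifold** = hypothesis `hext` (Lin (*4)) at the model: a holomorphic
`F : 𝔻 → ℂ` with `‖F‖ < 1` and `F q = 0` satisfies `‖F p‖ ≤ ‖φ_q(p)‖` everywhere (Schwarz's lemma for
`F ∘ φ_{−q}`, which fixes `0`; `φ_{−q} ∘ φ_q = id`). [cite: Conway1978, Ch. VI §2] -/
theorem unitDisc_norm_le_norm_discMobius (q : (⟨ball (0 : ℂ) 1, isOpen_ball⟩ : Opens ℂ))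
    (F : (⟨ball (0 : ℂ) 1, isOpen_ball⟩ : Opens ℂ) → ℂ) (hF : MDifferentiable 𝓘(ℂ, ℂ) 𝓘(ℂ, ℂ) F)
    (hlt : ∀ p, ‖F p‖ < 1) (hq : F q = 0) (p : (⟨ball (0 : ℂ) 1, isOpen_ball⟩ : Opens ℂ)) :
    ‖F p‖ ≤ ‖discMobius (q : ℂ) (p : ℂ)‖ := by
  set Fext : ℂ → ℂ := Function.extend Subtype.val F fun _ => 0 with hFext
  have hext_apply : ∀ x : (⟨ball (0 : ℂ) 1, isOpen_ball⟩ : Opens ℂ), Fext x = F x := fun x =>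
    Subtype.val_injective.extend_apply _ _ x
  have hqn : ‖(q : ℂ)‖ < 1 := unitDisc_norm_coe_lt_one q
  have hqn' : ‖(-(q : ℂ))‖ < 1 := by rwa [norm_neg]
  -- `G := Fext ∘ φ_{−q}` is holomorphic on the ball, maps it into the closed unit ball, and fixes `0`
  set G : ℂ → ℂ := fun w => Fext (discMobius (-(q : ℂ)) w) with hG
  have hGd : DifferentiableOn ℂ G (ball 0 1) :=
    (unitDisc_differentiableOn_extend hF).comp (differentiableOn_discMobius hqn') (mapsTo_discMobius hqn')
  have hGmaps : MapsTo G (ball 0 1) (closedBall 0 1) := by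
    intro w hw
    have hw' : discMobius (-(q : ℂ)) w ∈ ball (0 : ℂ) 1 := mapsTo_discMobius hqn' hw
    have : G w = F ⟨_, hw'⟩ := hext_apply ⟨_, hw'⟩
    rw [mem_closedBall_zero_iff, this]
    exact (hlt _).le
  have hG0 : G 0 = 0 := by
    have h1 : discMobius (-(q : ℂ)) 0 = q := by rw [discMobius_zero, neg_neg]
    show Fext (discMobius (-(q : ℂ)) 0) = 0
    rw [h1, hext_apply q, hq]
  -- Schwarz's lemma at `w := φ_q(p)`, and `φ_{−q}(φ_q(p)) = p`
  have hw : ‖discMobius (q : ℂ) (p : ℂ)‖ < 1 := unitDisc_norm_discMobius_lt_one q p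
  have key := norm_le_norm_of_mapsTo_ball hGd hGmaps hG0 hw
  have hback : discMobius (-(q : ℂ)) (discMobius (q : ℂ) (p : ℂ)) = p :=
    discMobius_neg_discMobius hqn (unitDisc_norm_coe_lt_one p).le
  have hGp : G (discMobius (q : ℂ) (p : ℂ)) = F p := by
    show Fext (discMobius (-(q : ℂ)) (discMobius (q : ℂ) (p : ℂ))) = F p
    rw [hback, hext_apply p]
  rwa [hGp] at key

/-- **NV WITNESS for the extremal-family interface of `RiemannSurfaceHeinsUnivalence`**: at the open unit
disc the Möbius family `f q p := φ_q(p)` satisfies the four hypotheses `hf`, `hlt`, `hz`, `hext` of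
`RiemannSurface.injective_of_extremal` (the last one being Schwarz–Pick).
[cite: Lin2011ClassicalComplexAnalysisII, §7.6.1 (7.6.1.1) (*4)] -/
theorem unitDisc_heinsHypotheses :
    (∀ q : (⟨ball (0 : ℂ) 1, isOpen_ball⟩ : Opens ℂ), MDifferentiable 𝓘(ℂ, ℂ) 𝓘(ℂ, ℂ)
        (fun p : (⟨ball (0 : ℂ) 1, isOpen_ball⟩ : Opens ℂ) => discMobius (q : ℂ) (p : ℂ))) ∧
    (∀ q p : (⟨ball (0 : ℂ) 1, isOpen_ball⟩ : Opens ℂ), ‖discMobius (q : ℂ) (p : ℂ)‖ < 1) ∧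
    (∀ q p : (⟨ball (0 : ℂ) 1, isOpen_ball⟩ : Opens ℂ), discMobius (q : ℂ) (p : ℂ) = 0 ↔ p = q) ∧
    (∀ (q : (⟨ball (0 : ℂ) 1, isOpen_ball⟩ : Opens ℂ))
        (F : (⟨ball (0 : ℂ) 1, isOpen_ball⟩ : Opens ℂ) → ℂ), MDifferentiable 𝓘(ℂ, ℂ) 𝓘(ℂ, ℂ) F →
        (∀ p, ‖F p‖ < 1) → F q = 0 → ∀ p, ‖F p‖ ≤ ‖discMobius (q : ℂ) (p : ℂ)‖) :=
  ⟨unitDisc_mdifferentiable_discMobius, unitDisc_norm_discMobius_lt_one, unitDisc_discMobius_eq_zero_iff,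
    unitDisc_norm_le_norm_discMobius⟩

/-- The disc-as-a-manifold is preconnected (a convex subset of `ℂ`). [folklore] -/
private theorem unitDisc_preconnectedSpace : PreconnectedSpace (⟨ball (0 : ℂ) 1, isOpen_ball⟩ : Opens ℂ) :=
  isPreconnected_iff_preconnectedSpace.1 (convex_ball (0 : ℂ) 1).isPreconnected

/-- **Heins' theorem applied at its model**: instantiating `RiemannSurface.injective_of_extremal` at the unit
disc with the Möbius family (all hypotheses discharged by `unitDisc_heinsHypotheses`) yields the
injectivity of every `p ↦ φ_q(p)` on the disc — of course also elementary (`Complex.injOn_discMobius`); the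
point is that the brick's hypotheses are met by the model it abstracts.
[cite: Lin2011ClassicalComplexAnalysisII, §7.6.1 (7.6.1.1) (*3)–(*5)] -/
theorem unitDisc_injective_discMobius_of_extremal (q : (⟨ball (0 : ℂ) 1, isOpen_ball⟩ : Opens ℂ)) :
    Injective (fun p : (⟨ball (0 : ℂ) 1, isOpen_ball⟩ : Opens ℂ) => discMobius (q : ℂ) (p : ℂ)) := by
  haveI := unitDisc_preconnectedSpace
  obtain ⟨hf, hlt, hz, hext⟩ := unitDisc_heinsHypotheses
  exact injective_of_extremal (f := fun q p : (⟨ball (0 : ℂ) 1, isOpen_ball⟩ : Opens ℂ) =>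
    discMobius (q : ℂ) (p : ℂ)) hf hlt hz hext q

end RiemannSurface

end Literature.Geometry.Kaehler

end
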